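import Summits.HodgeConjecture.HodgeConjecture.Theorems.PadicSemiregularLiftHodgeFermatVarietiesFibreOfTopLevel
import HarnessLib

/-!
# A non-paired Hodge sextuple at a level prime to `6` contains four points of a `5`-progression — line `cancel-by-any-claim-lattice`, crux `HodgeFermatVarieties` (stmt-HodgeConjecture-1334)

Lead c4's programme S16, registered stub S16-L2 `stub_exists_fibre_of_not_paired`: for `m` coprime to `6` with
`25 ∤ m`, `35 ∤ m`, a Hodge sextuple `s` of `ℤ/m` with `count x s ≠ count (-x) s` for some `x` contains all but
one of the five points `A + j(m/5)` (`j < 5`) of a progression with `5A ≠ 0`. Proof: realise `s` as a character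
`α : Fin 6 → ℤ/m`; the level of an entry with asymmetric multiplicity is non-even; take the non-even level `M`
with the least `m/M` (so every proper multiple of `M` is even) and apply the level analysis
`PairedNull.stub_fibre_of_top_level` (`…FibreOfTopLevel`): `M = 5n` and a full fibre `{crt⁻¹(y, b)}` of unit
parts of level-`M` entries; with `x₀ = crt⁻¹(0, b)` and `A = (m/M)·⟨x₀⟩` the entries above the fibre are
`A + j(m/5)`, `j = 1, …, 4` (the lift `x ↦ (m/M)·⟨x⟩` is additive and `crt⁻¹(jn, b) = x₀ + jn`), and
`5A = (m/n)·⟨x₀⟩ ≠ 0` because `x₀ ≡ b (mod n)` is a unit and `n > 1`.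

References: [Aoki1983] N. Aoki, Math. Ann. 266 (1983) 23–54, Thm. A′ (§7), Prop. 2.1.
-/

-- every sibling file of the line declares into `…CancelByAnyClaimLattice.PairedNull` from a differently named module
set_option linter.dupNamespace false

noncomputable section

open Finset
open Literature.AlgebraicGeometry.HodgeTheory Literature.AlgebraicGeometry.HodgeTheory.FermatCharacter

namespace Summit.HodgeConjecture.HodgeConjecture.Theorems.CancelByAnyClaimLattice

namespace PairedNull

/-! ### From the fibre to the progression: the registered stub S16-L2 -/

section Progression

variable {m : ℕ} [NeZero m]

omit [NeZero m] in
/-- The lift `x ↦ (m/M)·⟨x⟩ : ℤ/M → ℤ/m` is additive. [folklore] -/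
theorem divMul_val_add {M : ℕ} [NeZero M] (hMm : M ∣ m) (x y : ZMod M) :
    ((m / M : ℕ) : ZMod m) * (((x + y).val : ℕ) : ZMod m) =
      ((m / M : ℕ) : ZMod m) * ((x.val : ℕ) : ZMod m) + ((m / M : ℕ) : ZMod m) * ((y.val : ℕ) : ZMod m) := by
  have hdiv := Nat.div_add_mod (x.val + y.val) M
  rw [ZMod.val_add, ← mul_add, ← Nat.cast_add]
  have hq : ((m / M : ℕ) : ZMod m) * (((M * ((x.val + y.val) / M)) : ℕ) : ZMod m) = 0 := by
    rw [← Nat.cast_mul, ← mul_assoc, Nat.div_mul_cancel hMm, Nat.cast_mul, ZMod.natCast_self, zero_mul]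
  conv_rhs => rw [← hdiv, Nat.cast_add, mul_add, hq, zero_add]

/-- A residue is `(m/L)·⟨its unit part⟩` for its exact level `L`. [cite: Aoki1983, Prop. 2.1] -/
theorem eq_divMul_unitPart {L : ℕ} {x : ZMod m} (hlev : m / m.gcd x.val = L) :
    x = ((m / L : ℕ) : ZMod m) * ((((x.val / (m / L) : ℕ) : ZMod L)).val : ZMod m) := by
  subst hlev
  exact (unitPart_spec x).2.symm

/-- `(m/n)·t ≡ 0 (mod m)` iff `n ∣ t`, for `n ∣ m`. [folklore] -/
theorem divMul_natCast_eq_zero_iff {n : ℕ} (hnm : n ∣ m) (t : ℕ) :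
    ((m / n * t : ℕ) : ZMod m) = 0 ↔ n ∣ t := by
  rw [ZMod.natCast_eq_zero_iff]
  obtain ⟨k, hk⟩ := hnm
  have hk0 : 0 < k := Nat.pos_of_ne_zero fun h0 ↦ NeZero.ne m (by rw [hk, h0, mul_zero])
  have hn0 : 0 < n := Nat.pos_of_ne_zero fun h0 ↦ NeZero.ne m (by rw [hk, h0, zero_mul])
  rw [hk, Nat.mul_div_cancel_left k hn0, mul_comm n k]
  exact Nat.mul_dvd_mul_iff_left hk0

/-- **S16-L2 `stub_exists_fibre_of_not_paired`** — a non-paired Hodge sextuple at a level `m` prime to `6`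
(`25 ∤ m`, `35 ∤ m`) contains all but one of the five points of a progression `{A + j(m/5)}` with `5A ≠ 0`
(from `stub_fibre_of_top_level` at the top non-even level `M = 5n`: `A = (m/M)·⟨crt⁻¹(0, b)⟩`, the excluded
point `j₀ = 0` being the non-unit point of the fibre). [cite: Aoki1983, Thm. A′ (§7)] -/
theorem stub_exists_fibre_of_not_paired : ∀ (m : ℕ) [NeZero m], m.Coprime 6 → ¬ 25 ∣ m → ¬ 35 ∣ m → ∀ s : Multiset (ZMod m), IsHodgeMultiset s → Multiset.card s = 6 → (∃ x : ZMod m, Multiset.count x s ≠ Multiset.count (-x) s) → 5 ∣ m ∧ ∃ A : ZMod m, (5 : ZMod m) * A ≠ 0 ∧ ∃ j₀ : ℕ, j₀ < 5 ∧ ∀ j : ℕ, j < 5 → j ≠ j₀ → A + (j : ZMod m) * ((m / 5 : ℕ) : ZMod m) ∈ s := by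
  intro m _ hm6 h25 h35 s hs h6 hns
  classical
  have hm0 : m ≠ 0 := NeZero.ne m
  obtain ⟨r, α, hα, rfl⟩ := hs.exists_isHodge
  have hr : r = 6 := by rw [card_univ_val_map] at h6; exact h6
  subst hr
  -- the non-even level of some entry
  obtain ⟨x, hx⟩ := hns
  rw [count_univ_val_map, count_univ_val_map] at hx
  have hx0 : x ≠ 0 := by
    rintro rfl
    rw [neg_zero] at hx
    exact hx rfl
  have hfibre : ∀ (M : ℕ) (y : ZMod m), m / m.gcd y.val = M →
      (univ.filter fun i : Fin 6 ↦ α i = y) =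
        univ.filter fun i : Fin 6 ↦ m / m.gcd (α i).val = M ∧
          ((((α i).val / (m / M)) : ℕ) : ZMod M) = (((y.val / (m / M)) : ℕ) : ZMod M) := by
    intro M y hy
    ext i
    simp only [mem_filter, mem_univ, true_and]
    constructor
    · rintro rfl; exact ⟨hy, rfl⟩
    · rintro ⟨hli, hri⟩
      exact eq_of_level_eq_of_unitPart_eq hli hy hri
  set P : ℕ → Prop := fun d ↦ ∃ M : ℕ, M ∣ m ∧ m / M = d ∧ ∃ v : ZMod M,
      #(univ.filter fun i : Fin 6 ↦ m / m.gcd (α i).val = M ∧ ((((α i).val / (m / M)) : ℕ) : ZMod M) = -v) ≠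
      #(univ.filter fun i : Fin 6 ↦ m / m.gcd (α i).val = M ∧ ((((α i).val / (m / M)) : ℕ) : ZMod M) = v) with hP
  have hPex : ∃ d, P d := by
    refine ⟨m / (m / m.gcd x.val), m / m.gcd x.val, level_dvd x, rfl, (((x.val / (m / (m / m.gcd x.val))) : ℕ)), ?_⟩
    rw [← unitPart_neg hx0 rfl, ← hfibre _ (-x) (level_neg x), ← hfibre _ x rfl]
    exact Ne.symm hx
  -- the top non-even level `M` (least `d = m / M`)
  obtain ⟨M, hMm, hdM, hne⟩ := Nat.find_spec hPex
  have hM0 : M ≠ 0 := fun h0 ↦ hm0 (by rw [h0] at hMm; exact zero_dvd_iff.mp hMm)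
  have hIH : ∀ M' : ℕ, M' ∣ m → M ∣ M' → M' ≠ M → ∀ u : ZMod M',
      #(univ.filter fun i : Fin 6 ↦ m / m.gcd (α i).val = M' ∧ ((((α i).val / (m / M')) : ℕ) : ZMod M') = -u) =
      #(univ.filter fun i : Fin 6 ↦ m / m.gcd (α i).val = M' ∧ ((((α i).val / (m / M')) : ℕ) : ZMod M') = u) := by
    intro M' hM'm hMM' hneM u
    have hM'0 : M' ≠ 0 := fun h0 ↦ hm0 (by rw [h0] at hM'm; exact zero_dvd_iff.mp hM'm)
    have hlt : m / M' < Nat.find hPex := by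
      rw [← hdM]
      obtain ⟨t, rfl⟩ := hMM'
      obtain ⟨s', hs'⟩ := hM'm
      have ht1 : t ≠ 1 := fun h1 ↦ hneM (by rw [h1, mul_one])
      have ht0 : t ≠ 0 := fun h0 ↦ hM'0 (by rw [h0, mul_zero])
      have hs0 : 0 < s' := Nat.pos_of_ne_zero fun h0 ↦ hm0 (by rw [hs', h0, mul_zero])
      have h1 : m / (M * t) = s' := by rw [hs', Nat.mul_div_cancel_left _ (Nat.pos_of_ne_zero hM'0)]
      have h2 : m / M = t * s' := by
        rw [hs', mul_assoc, Nat.mul_div_cancel_left _ (Nat.pos_of_ne_zero hM0)]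
      rw [h1, h2]
      calc s' = 1 * s' := (one_mul s').symm
        _ < t * s' := Nat.mul_lt_mul_of_lt_of_le (by omega) (le_refl s') hs0
    have hmin := Nat.find_min hPex hlt
    simp only [hP, not_exists, not_and, not_not] at hmin
    exact hmin M' hM'm rfl u
  obtain ⟨n, hc, hMn, hn1, b, hbu, hfib⟩ := fibre_of_top_level hm6 h25 h35 hα hMm hne hIH
  subst hMn
  have hn0 : n ≠ 0 := by omega
  haveI : NeZero n := ⟨hn0⟩
  have h5m : 5 ∣ m := (dvd_mul_right 5 n).trans hMm
  obtain ⟨k, hk⟩ := hMm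
  have hk0 : k ≠ 0 := fun h0 ↦ hm0 (by rw [hk, h0, mul_zero])
  have hdiv5n : m / (5 * n) = k := by rw [hk, Nat.mul_div_cancel_left _ (by positivity)]
  have hdiv5 : m / 5 = n * k := by rw [hk, mul_assoc, Nat.mul_div_cancel_left _ (by norm_num)]
  have hdivn : m / n = 5 * k := by
    rw [hk, show 5 * n * k = n * (5 * k) by ring, Nat.mul_div_cancel_left _ (Nat.pos_of_ne_zero hn0)]
  -- the base point `x₀ = crt⁻¹(0, b)` and `A = (m/(5n))·⟨x₀⟩`
  set x₀ : ZMod (5 * n) := (ZMod.chineseRemainder hc).symm (0, b) with hx₀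
  refine ⟨h5m, ((m / (5 * n) : ℕ) : ZMod m) * ((x₀.val : ℕ) : ZMod m), ?_, 0, by norm_num, fun j hj hj0 ↦ ?_⟩
  · -- `5A ≠ 0`: `5A = (m/n)·⟨x₀⟩` and `n ∤ ⟨x₀⟩` as `x₀ ≡ b (mod n)`, `b` a unit, `n > 1`
    intro h0
    have h5A : (5 : ZMod m) * (((m / (5 * n) : ℕ) : ZMod m) * ((x₀.val : ℕ) : ZMod m)) =
        ((m / n * x₀.val : ℕ) : ZMod m) := by
      rw [hdivn, hdiv5n]; push_cast; ring
    rw [h5A, divMul_natCast_eq_zero_iff ((dvd_mul_left n 5).trans ⟨k, hk⟩)] at h0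
    have hb : (ZMod.castHom (dvd_mul_left n 5) (ZMod n)) x₀ = b := (castHom_crt_symm hc 0 b).2
    rw [ZMod.castHom_apply, ZMod.cast_eq_val, (ZMod.natCast_eq_zero_iff _ _).mpr h0] at hb
    haveI : Fact (1 < n) := ⟨hn1⟩
    exact hbu.ne_zero hb.symm
  · -- the point `A + j(m/5)` is the entry above `crt⁻¹(jn, b)`
    have hjn5 : ¬ 5 ∣ j * n := fun hd ↦ by
      rcases (Nat.Prime.dvd_mul Nat.prime_five).mp hd with hd | hd
      · exact absurd (Nat.le_of_dvd (by omega) hd) (by omega)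
      · exact (Nat.Prime.coprime_iff_not_dvd Nat.prime_five).mp hc hd
    have hy0 : ((j * n : ℕ) : ZMod 5) ≠ 0 := by rwa [Ne, ZMod.natCast_eq_zero_iff]
    haveI : Fact (Nat.Prime 5) := ⟨Nat.prime_five⟩
    have hyu : IsUnit ((j * n : ℕ) : ZMod 5) := isUnit_iff_ne_zero.mpr hy0
    obtain ⟨i, hlev, hup⟩ := hfib hyu.unit
    rw [IsUnit.unit_spec] at hup
    -- `crt⁻¹(jn, b) = x₀ + jn`
    have hxj : (ZMod.chineseRemainder hc).symm (((j * n : ℕ) : ZMod 5), b) = x₀ + ((j * n : ℕ) : ZMod (5 * n)) := by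
      have h1 : ZMod.castHom (dvd_mul_right 5 n) (ZMod 5) (x₀ + ((j * n : ℕ) : ZMod (5 * n))) =
          ((j * n : ℕ) : ZMod 5) := by
        rw [map_add, map_natCast, hx₀, (castHom_crt_symm hc 0 b).1, zero_add]
      have h2 : ZMod.castHom (dvd_mul_left n 5) (ZMod n) (x₀ + ((j * n : ℕ) : ZMod (5 * n))) = b := by
        rw [map_add, map_natCast, hx₀, (castHom_crt_symm hc 0 b).2, Nat.cast_mul, ZMod.natCast_self, mul_zero,
          add_zero]
      rw [← h1, ← h2]
      exact crt_symm_castHom hc _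
    have hαi : α i = ((m / (5 * n) : ℕ) : ZMod m) * ((x₀.val : ℕ) : ZMod m) + (j : ZMod m) * ((m / 5 : ℕ) : ZMod m) := by
      rw [eq_divMul_unitPart hlev, hup, hxj, divMul_val_add ⟨k, hk⟩]
      congr 1
      have hval : (((j * n : ℕ) : ZMod (5 * n))).val = j * n := by
        rw [ZMod.val_natCast, Nat.mod_eq_of_lt (by nlinarith [Nat.pos_of_ne_zero hn0])]
      rw [hval, hdiv5n, hdiv5]
      push_cast
      ring
    rw [← hαi]
    exact Multiset.mem_map_of_mem _ (Finset.mem_univ_val i)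

end Progression

end PairedNull

end Summit.HodgeConjecture.HodgeConjecture.Theorems.CancelByAnyClaimLattice

end
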